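import Literature.Computability.AlgebraicComplexity.BLMW11WeaklySkewDetProofs
import Literature.Computability.AlgebraicComplexity.BLMW11VPwsBarSubsetVPBar
import Literature.Computability.AlgebraicComplexity.FormulaUnfolding
import Literature.Computability.AlgebraicComplexity.BLMW11WeaklySkewToSkewProofs
import Literature.Computability.AlgebraicComplexity.VNPeEqVNP
import HarnessLib

/-!
# BLMW 2011 §9.1: formulas are weakly skew — `L(f) ≤ L_ws(f) ≤ L_e(f)`, `VP_e ⊆ VP_ws ⊆ VP`

Bürgisser–Landsberg–Manivel–Weyman 2011, §9.1 (arXiv:0907.2850, p. 20): "The circuit is called a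
formula if the underlying graph is a tree. … Formulas are a very restrictive model; weakly-skew
circuits, introduced in [Toda; Malod–Portier], are less restrictive: here we require that for each
multiplication gate `α`, at least one of the two vertices pointing to `α` is computed by a separate
subcircuit `C_α`. … one defines the corresponding complexity notion `L_ws(f)`. Clearly,
`L_e(f) ≥ L_ws(f) ≥ L(f)`. … Note that `VP_e ⊆ VP_ws ⊆ VP`."

For the tree's straight-line vocabulary (`ArithCircuit.IsFormula`, `CircuitDepth.lean`: every gate
index is referenced at most once among all operand occurrences; `ArithCircuit.IsWeaklySkew` /
`IsSeparateOperand` / `subcircuit`, `BLMW11KroneckerApproximation.lean`; the measures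
`formulaComplexity` = `L_e`, `wsComplexity` = `L_ws`, `complexity` = `L`):

* `ArithCircuit.IsFormula.isSeparateOperand`: in a formula, EVERY gate operand `gate j` of a gate
  `i` is computed by a separate sub-circuit `C_j` — the unique reference to a gate of `C_j` from
  outside `C_j` is the edge `j → i` (a gate `j' ≠ j` of `C_j` is referenced from inside `C_j`,
  along the path from `j`, and references are unique);
* `ArithCircuit.IsFormula.isWeaklySkew`: hence a formula is weakly skew (no well-formedness or
  fan-in hypothesis needed);
* `wsComplexity_le_formulaComplexity`: `L_ws(f) ≤ L_e(f)` (a size-optimal fan-in-two formula is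
  unfolded to a well-formed one of the same size by the tree's `WExpr` bridge,
  `FormulaUnfolding.lean`), and the chain `complexity_le_formulaComplexity'`;
* family level: `IsVPwsFamily.of_isPBounded_formulaComplexity` (`VP_e ⊆ VP_ws`: p-bounded
  expression size ⇒ `IsVPwsFamily`) and `IsVPwsFamily.isVPFamily` (`VP_ws ⊆ VP`, for families in
  p-bounded many variables: the degree bound is the tree's
  `IsVPwsFamily.isPBounded_totalDegree`, BLMW §9.1 "the degree of polynomials computed by
  weakly skew circuits is polynomially bounded a priori").

* `IsProjection.formulaComplexity_le`, `formulaComplexity_rename_equiv`,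
  `isPBounded_formulaComplexity_of_isPProjection` (`VP_e` is closed under p-projections) and
  `vpws_subset_vpe_iff_isPBounded_formulaComplexity_detPoly` /
  `vpe_eq_vpws_iff_isPBounded_formulaComplexity_detPoly`: "Therefore, `VP_e = VP_ws` is
  equivalent to `(det_n) ∈ VP_e`" (p. 20), from the `VP_ws`-completeness of `(det_n)`
  (`BLMW2011_sec9_detVPws_holds`).

* `isQPBounded_wsComplexity_iff_isQPBounded_complexity`,
  `isQPBounded_formulaComplexity_iff_isQPBounded_wsComplexity`,
  `isVQPFamily_iff_isQPBounded_wsComplexity`: "when replacing polynomial upper bounds by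
  quasipolynomial upper bounds … all these classes coincide" (p. 20), through the tree's
  `BCS1997_thm_21_33_holds` (`VQP_e = VQP`).

* `ArithExpr.formulaComplexity_eval_le` / `ArithExpr.wsComplexity_eval_le` (the expression carrier
  of `PermanentCompleteness.lean` against `E` and `L_ws`) and
  `isVNPFamily_iff_exists_isVPwsFamily_boolSum` /
  `isVNPFamily_iff_exists_isPBounded_formulaComplexity_boolSum`: "`VNP_e = VNP_ws = VNP`" (p. 20),
  through Valiant's `VNP = VNP_e` in the tree (`BCS1997_thm_21_26_holds`).

Theorems only (no new definitions or facts); cell `val-lit`, seat t14.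

## References
* [BLMW 2011] P. Bürgisser, J. M. Landsberg, L. Manivel, J. Weyman, *An overview of mathematical
  issues arising in the geometric complexity theory approach to VP ≠ VNP*, SIAM J. Comput. 40
  (2011), §9.1 (arXiv:0907.2850 p. 20). Bib key `BurgisserEtAl2011`.
* [Malod–Portier 2008] G. Malod, N. Portier, *Characterizing Valiant's algebraic complexity
  classes*, J. Complexity 24 (2008) (weakly-skew circuits). Cited through BLMW.
-/

open MvPolynomial

namespace Literature.Computability.AlgebraicComplexity

namespace ArithCircuit

section Refs

variable {k : Type*} {σ : Type*}

/-- Counting the references of a gate to gate `j`: the multiplicity of `j` in `g.refs` is the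
number of operand occurrences `gate j` of `g` (bookkeeping between `Gate.refs`, BLMW §9.1, and
`Operand.refersTo`, the formula predicate). [cite: BurgisserEtAl2011, §9.1] -/
theorem Gate.count_refs_eq_countP (g : Gate k σ) (j : ℕ) :
    g.refs.count j = g.args.countP (Operand.refersTo j) := by
  unfold Gate.refs
  generalize g.args = l
  induction l with
  | nil => rfl
  | cons u l ih =>
    cases u with
    | var i => simpa [List.filterMap_cons, Operand.refersTo] using ih
    | const c => simpa [List.filterMap_cons, Operand.refersTo] using ih
    | gate i =>
      simp only [List.filterMap_cons, List.count_cons, List.countP_cons, Operand.refersTo, ih,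
        beq_iff_eq]

/-- Two entries of a list of naturals at distinct positions sum to at most the total. [cite: BurgisserEtAl2011, §9.1] -/
private theorem getElem_add_getElem_le_sum :
    ∀ (L : List ℕ) {a b : ℕ} (ha : a < L.length) (hb : b < L.length), a ≠ b →
      L[a] + L[b] ≤ L.sum
  | [], a, b, ha, _, _ => by simp at ha
  | x :: L, 0, 0, _, _, h => (h rfl).elim
  | x :: L, 0, b + 1, _, hb, _ => by
      simp only [List.getElem_cons_zero, List.getElem_cons_succ, List.sum_cons]
      have := List.le_sum_of_mem (List.getElem_mem (l := L) (n := b) (by simpa using hb))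
      omega
  | x :: L, a + 1, 0, ha, _, _ => by
      simp only [List.getElem_cons_zero, List.getElem_cons_succ, List.sum_cons]
      have := List.le_sum_of_mem (List.getElem_mem (l := L) (n := a) (by simpa using ha))
      omega
  | x :: L, a + 1, b + 1, ha, hb, h => by
      simp only [List.getElem_cons_succ, List.sum_cons]
      have := getElem_add_getElem_le_sum L (by simpa using ha) (by simpa using hb)
        (fun e => h (by rw [e]))
      omega

/-- The references to `j` from one gate are among all operand occurrences referring to `j`. [cite: BurgisserEtAl2011, §9.1] -/
theorem count_refs_le_countP_operands (P : ArithCircuit k σ) {l : ℕ} {g : Gate k σ}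
    (hg : P.gates[l]? = some g) (j : ℕ) :
    g.refs.count j ≤ P.operands.countP (Operand.refersTo j) := by
  rw [Gate.count_refs_eq_countP, operands, List.countP_append, List.countP_flatMap]
  obtain ⟨hl, rfl⟩ := List.getElem?_eq_some_iff.1 hg
  have hmem : (P.gates[l]).args.countP (Operand.refersTo j) ∈
      P.gates.map (fun g => g.args.countP (Operand.refersTo j)) :=
    List.mem_map.2 ⟨_, List.getElem_mem hl, rfl⟩
  exact (List.le_sum_of_mem hmem).trans (Nat.le_add_right _ _)

/-- The references to `j` from two DISTINCT gates together are among all operand occurrences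
referring to `j`. [cite: BurgisserEtAl2011, §9.1] -/
theorem count_refs_add_le_countP_operands (P : ArithCircuit k σ) {a b : ℕ} (hab : a ≠ b)
    {ga gb : Gate k σ} (ha : P.gates[a]? = some ga) (hb : P.gates[b]? = some gb) (j : ℕ) :
    ga.refs.count j + gb.refs.count j ≤ P.operands.countP (Operand.refersTo j) := by
  rw [Gate.count_refs_eq_countP, Gate.count_refs_eq_countP, operands, List.countP_append,
    List.countP_flatMap]
  obtain ⟨hal, rfl⟩ := List.getElem?_eq_some_iff.1 ha
  obtain ⟨hbl, rfl⟩ := List.getElem?_eq_some_iff.1 hb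
  have h := getElem_add_getElem_le_sum
    (P.gates.map (fun g => g.args.countP (Operand.refersTo j)))
    (a := a) (b := b) (by simpa using hal) (by simpa using hbl) hab
  simp only [List.getElem_map] at h
  exact h.trans (Nat.le_add_right _ _)

end Refs

section Formula

variable {k : Type*} {σ : Type*} {P : ArithCircuit k σ}

/-- In a formula a referenced gate is referenced exactly once by the referencing gate. [cite: BurgisserEtAl2011, §9.1 (formulas: the underlying graph is a tree)] -/
theorem IsFormula.count_refs_eq_one (hF : P.IsFormula) {l j : ℕ} {g : Gate k σ}
    (hg : P.gates[l]? = some g) (hj : j ∈ g.refs) : g.refs.count j = 1 :=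
  le_antisymm ((P.count_refs_le_countP_operands hg j).trans (hF j)) (List.count_pos_iff.2 hj)

/-- In a formula a gate referenced by gate `a` is referenced by no other gate `b ≠ a`. [cite: BurgisserEtAl2011, §9.1 (formulas: the underlying graph is a tree)] -/
theorem IsFormula.count_refs_eq_zero_of_ne (hF : P.IsFormula) {a b j : ℕ} (hab : a ≠ b)
    {ga gb : Gate k σ} (ha : P.gates[a]? = some ga) (hb : P.gates[b]? = some gb)
    (hj : j ∈ ga.refs) : gb.refs.count j = 0 := by
  have h1 := (P.count_refs_add_le_countP_operands hab ha hb j).trans (hF j)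
  have h2 := List.count_pos_iff.2 hj
  omega

/-- **In a formula every gate operand is computed by a separate sub-circuit** (BLMW 2011 §9.1):
if gate `i` references gate `j`, then the only reference to a gate of `C_j = P.subcircuit j` from
outside `C_j` is the single reference of `i` to `j` — a gate `j' ≠ j` of `C_j` is referenced by its
predecessor on the path from `j`, which lies in `C_j`, and references in a formula are unique.
[cite: BurgisserEtAl2011, §9.1 (weakly-skew circuits; formulas)] -/
theorem IsFormula.isSeparateOperand (hF : P.IsFormula) {i j : ℕ} {g : Gate k σ}
    (hg : P.gates[i]? = some g) (hj : j ∈ g.refs) : P.IsSeparateOperand i j := by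
  intro l hl g' hg' j' hj'
  by_cases hjj : j' = j
  · subst hjj
    by_cases hli : l = i
    · subst hli
      rw [hg] at hg'
      cases hg'
      rw [if_pos ⟨rfl, rfl⟩]
      exact hF.count_refs_eq_one hg hj
    · rw [if_neg fun h => hli h.1]
      exact hF.count_refs_eq_zero_of_ne (Ne.symm hli) hg hg' hj
  · rw [if_neg fun h => hjj h.2]
    rcases Relation.ReflTransGen.cases_tail hj' with h | ⟨p, hp, hpj'⟩
    · exact (hjj h).elim
    · obtain ⟨gp, hgp, hj'p⟩ := hpj'
      have hpl : p ≠ l := fun e => hl (e ▸ hp)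
      exact hF.count_refs_eq_zero_of_ne hpl hgp hg' hj'p

/-- **Formulas are weakly skew** (BLMW 2011 §9.1: formulas are the more restrictive model —
"for each multiplication gate `α`, at least one of the two vertices pointing to `α` is computed by
a separate subcircuit" holds for every operand of every gate of a formula). No well-formedness or
fan-in hypothesis is needed. [cite: BurgisserEtAl2011, §9.1 (weakly-skew circuits; formulas)] -/
theorem IsFormula.isWeaklySkew (hF : P.IsFormula) : P.IsWeaklySkew := by
  intro i args hg hne
  obtain ⟨u, hu⟩ := List.exists_mem_of_ne_nil args hne
  refine ⟨u, hu, ?_⟩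
  cases u with
  | var x => exact Or.inl rfl
  | const c => exact Or.inl rfl
  | gate j => exact Or.inr ⟨j, rfl, hF.isSeparateOperand hg ((mem_refs_iff (.prod args) j).2 hu)⟩

end Formula

end ArithCircuit

/-! ## The measures: `L(f) ≤ L_ws(f) ≤ L_e(f)` -/

section Measures

variable {k : Type*} [CommSemiring k] {σ : Type*}

open ArithCircuit

/-- **`L_ws(f) ≤ L_e(f)`** (BLMW 2011 §9.1: "Clearly, `L_e(f) ≥ L_ws(f) ≥ L(f)`"): a size-optimal
fan-in-two formula for `f` unfolds (the tree's `WExpr` bridge) to a well-formed fan-in-two formula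
with at most `E(f)` gates, which is weakly skew by `IsFormula.isWeaklySkew`. [cite: BurgisserEtAl2011, §9.1 (L_e ≥ L_ws ≥ L)] -/
theorem wsComplexity_le_formulaComplexity (f : MvPolynomial σ k) :
    wsComplexity f ≤ formulaComplexity f := by
  obtain ⟨e, he, hs⟩ := exists_wexpr_size_le_formulaComplexity f
  obtain ⟨P, hW, hF, h2, hPe, hPs⟩ := e.exists_formula
  have hc : P.Computes f := by rw [ArithCircuit.Computes, hPe, he]
  exact (wsComplexity_le_size P hW h2 hF.isWeaklySkew hc).trans (hPs.trans hs)

/-- The chain `L(f) ≤ L_ws(f) ≤ L_e(f)` of BLMW 2011 §9.1, outer inequality (the tree's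
`complexity_le_formulaComplexity_holds` by way of weakly-skew circuits). [cite: BurgisserEtAl2011, §9.1 (L_e ≥ L_ws ≥ L)] -/
theorem complexity_le_wsComplexity_le_formulaComplexity (f : MvPolynomial σ k) :
    complexity f ≤ wsComplexity f ∧ wsComplexity f ≤ formulaComplexity f :=
  ⟨complexity_le_wsComplexity f, wsComplexity_le_formulaComplexity f⟩

/-- A fan-in-two formula computing `f` bounds `L_ws(f)` by its size (formulas need not be well
formed: pass through `E(f)`). [cite: BurgisserEtAl2011, §9.1 (L_e ≥ L_ws)] -/
theorem wsComplexity_le_size_of_isFormula {P : ArithCircuit k σ} {f : MvPolynomial σ k}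
    (hF : P.IsFormula) (h2 : P.IsFanInTwo) (hc : P.Computes f) : wsComplexity f ≤ P.size :=
  (wsComplexity_le_formulaComplexity f).trans (formulaComplexity_le_size hF h2 hc)

end Measures

/-! ## The classes: `VP_e ⊆ VP_ws ⊆ VP` -/

section Classes

variable {k : Type*} [CommSemiring k] {σ : ℕ → Type*}

/-- **`VP_e ⊆ VP_ws`** (BLMW 2011 §9.1: "Note that `VP_e ⊆ VP_ws ⊆ VP`"): a family of p-bounded
expression size `E(f_n)` has p-bounded weakly-skew complexity. [cite: BurgisserEtAl2011, §9.1 (VP_e ⊆ VP_ws ⊆ VP)] -/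
theorem IsVPwsFamily.of_isPBounded_formulaComplexity {f : ∀ n, MvPolynomial (σ n) k}
    (hf : IsPBounded fun n => formulaComplexity (f n)) : IsVPwsFamily f :=
  hf.mono fun n => wsComplexity_le_formulaComplexity (f n)

/-- **`VP_ws ⊆ VP`** (BLMW 2011 §9.1: "Note that `VP_e ⊆ VP_ws ⊆ VP`"; "the degree of polynomials
computed by weakly skew circuits is polynomially bounded a priori"): a family in p-bounded many
variables with p-bounded weakly-skew complexity is a `VP` family — its degree is p-bounded by the
tree's `IsVPwsFamily.isPBounded_totalDegree` and `L ≤ L_ws`. [cite: BurgisserEtAl2011, §9.1 (VP_e ⊆ VP_ws ⊆ VP)] -/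
theorem IsVPwsFamily.isVPFamily [∀ n, Fintype (σ n)] {f : ∀ n, MvPolynomial (σ n) k}
    (hf : IsVPwsFamily f) (hσ : IsPBounded fun n => Fintype.card (σ n)) : IsVPFamily f :=
  ⟨⟨hσ, hf.isPBounded_totalDegree⟩, hf.isPBounded_complexity⟩

/-- **`VP_e ⊆ VP`** through `VP_ws` (BLMW 2011 §9.1), for families in p-bounded many variables.
[cite: BurgisserEtAl2011, §9.1 (VP_e ⊆ VP_ws ⊆ VP)] -/
theorem isVPFamily_of_isPBounded_formulaComplexity [∀ n, Fintype (σ n)]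
    {f : ∀ n, MvPolynomial (σ n) k} (hf : IsPBounded fun n => formulaComplexity (f n))
    (hσ : IsPBounded fun n => Fintype.card (σ n)) : IsVPFamily f :=
  (IsVPwsFamily.of_isPBounded_formulaComplexity hf).isVPFamily hσ

end Classes

/-! ## `E` under projections; "`VP_e = VP_ws` is equivalent to `(det_n) ∈ VP_e`" -/

section FormulaProjection

variable {k : Type*} [CommSemiring k] {σ τ : Type*}

/-- `E(X_j) = 0` (a leaf; the tree's `formulaComplexity_X_eq_zero` of the Andrews–Forbes files,
re-derived here from the `WExpr` bridge to keep imports light). [cite: BurgisserClausenShokrollahi1997, (21.19)] -/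
private theorem formulaComplexity_X_le_zero (j : τ) :
    formulaComplexity (X j : MvPolynomial τ k) ≤ 0 :=
  (exists_wexpr_iff_formulaComplexity_le _ 0).mp ⟨.var j, WExpr.eval_var j, le_rfl⟩

/-- `E(C c) = 0` (a leaf). [cite: BurgisserClausenShokrollahi1997, (21.19)] -/
private theorem formulaComplexity_C_le_zero (c : k) :
    formulaComplexity (C c : MvPolynomial τ k) ≤ 0 :=
  (exists_wexpr_iff_formulaComplexity_le _ 0).mp ⟨.const c, WExpr.eval_const c, le_rfl⟩

/-- **`E(g) ≤ E(f)` for a projection `g` of `f`**: substituting variables and constants for the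
variables of a formula is free (BLMW 2011 §9.1: the classes are compared under p-projections;
BCS 1997, §21.1). Via the tree's `formulaComplexity_bind₁_le` with leaf cost `0`. [cite: BurgisserEtAl2011, §9.1 (VP_e, projections)] -/
theorem IsProjection.formulaComplexity_le {g : MvPolynomial τ k} {f : MvPolynomial σ k}
    (h : IsProjection g f) : formulaComplexity g ≤ formulaComplexity f := by
  obtain ⟨a, ha, rfl⟩ := h
  change formulaComplexity (bind₁ a f) ≤ _
  refine (formulaComplexity_bind₁_le (B := 0) (fun i => ?_) f).trans (by omega)
  rcases ha i with ⟨j, hj⟩ | ⟨c, hc⟩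
  · rw [hj]; exact formulaComplexity_X_le_zero j
  · rw [hc]; exact formulaComplexity_C_le_zero c

/-- `E` is invariant under renaming along a bijection of the variables. [cite: BurgisserEtAl2011, §9.1 (VP_e)] -/
theorem formulaComplexity_rename_equiv (e : σ ≃ τ) (f : MvPolynomial σ k) :
    formulaComplexity (rename e f) = formulaComplexity f := by
  refine le_antisymm (isProjection_rename e f).formulaComplexity_le ?_
  have h := (isProjection_rename e.symm (rename e f)).formulaComplexity_le
  rwa [rename_rename, e.symm_comp_self, rename_id] at h

/-- **p-bounded expression size passes to p-projections** (`VP_e` is closed under p-projections;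
BLMW 2011 §9.1). [cite: BurgisserEtAl2011, §9.1 (VP_e, projections)] -/
theorem isPBounded_formulaComplexity_of_isPProjection {σ' τ' : ℕ → Type*}
    {f : ∀ n, MvPolynomial (σ' n) k} {g : ∀ n, MvPolynomial (τ' n) k}
    (hg : IsPBounded fun n => formulaComplexity (g n)) (h : IsPProjection f g) :
    IsPBounded fun n => formulaComplexity (f n) := by
  obtain ⟨t, ht, hproj⟩ := h
  exact (IsPBounded.comp_holds hg ht).mono fun n => (hproj n).formulaComplexity_le

end FormulaProjection

section DetVPe

/-- **BLMW 2011 §9.1 (p. 20): "Therefore, `VP_e = VP_ws` is equivalent to `(det_n) ∈ VP_e`, the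
major open question mentioned before."** Over `ℂ`, for families in the variables `Fin (v n)`:
since `VP_e ⊆ VP_ws` always (`IsVPwsFamily.of_isPBounded_formulaComplexity`), "`VP_e = VP_ws`" is
the inclusion `VP_ws ⊆ VP_e` on the left; on the right, `n ↦ E(det_n)` is p-bounded. (⇐) by the
`VP_ws`-completeness of `(det_n)` under p-projections (the tree's `BLMW2011_sec9_detVPws_holds`,
clause (ii)) and `isPBounded_formulaComplexity_of_isPProjection`; (⇒) applied to `(det_n) ∈ VP_ws`
(clause (i)), placed in the variables `Fin (n·n)`. An equivalence of two OPEN statements; nothing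
is asserted. [cite: BurgisserEtAl2011, §9.1 (VP_e = VP_ws iff det in VP_e)] -/
theorem vpws_subset_vpe_iff_isPBounded_formulaComplexity_detPoly :
    (∀ (v : ℕ → ℕ) (f : ∀ n, MvPolynomial (Fin (v n)) ℂ), IsVPwsFamily f →
        IsPBounded fun n => formulaComplexity (f n)) ↔
      IsPBounded fun n => formulaComplexity (detPoly (Fin n) ℂ) := by
  constructor
  · intro h
    have hws : IsVPwsFamily fun n => rename (finProdFinEquiv : Fin n × Fin n ≃ Fin (n * n))
        (detPoly (Fin n) ℂ) :=
      BLMW2011_sec9_detVPws_holds.1.mono fun n => (wsComplexity_rename_equiv _ _).le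
    exact (h _ _ hws).mono fun n => (formulaComplexity_rename_equiv _ _).symm.le
  · intro hdet v f hf
    exact isPBounded_formulaComplexity_of_isPProjection hdet
      (BLMW2011_sec9_detVPws_holds.2.1 v f hf)

/-- The same with `VP_e = VP_ws` spelled as a bi-implication on families in the variables
`Fin (v n)` (the inclusion `VP_e ⊆ VP_ws` being unconditional). [cite: BurgisserEtAl2011, §9.1 (VP_e = VP_ws iff det in VP_e)] -/
theorem vpe_eq_vpws_iff_isPBounded_formulaComplexity_detPoly :
    (∀ (v : ℕ → ℕ) (f : ∀ n, MvPolynomial (Fin (v n)) ℂ),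
        IsVPwsFamily f ↔ IsPBounded fun n => formulaComplexity (f n)) ↔
      IsPBounded fun n => formulaComplexity (detPoly (Fin n) ℂ) := by
  rw [← vpws_subset_vpe_iff_isPBounded_formulaComplexity_detPoly]
  exact ⟨fun h v f hf => (h v f).mp hf,
    fun h v f => ⟨h v f, IsVPwsFamily.of_isPBounded_formulaComplexity⟩⟩

end DetVPe

/-! ## "Replacing polynomial by quasipolynomial upper bounds … all these classes coincide" -/

section QuasiPolynomial

variable {k : Type*} [Field k] {σ : ℕ → Type*} [∀ n, Fintype (σ n)]

/-- Monotonicity of qp-boundedness (the tree's `IsQPBounded.mono` of `QPBoundedClosure.lean`,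
restated privately to keep imports light). [cite: Burgisser2000, Def. 2.26] -/
private theorem isQPBounded_of_le {s t : ℕ → ℕ} (ht : IsQPBounded t) (h : ∀ n, s n ≤ t n) :
    IsQPBounded s := by
  obtain ⟨c, hc⟩ := ht
  exact ⟨c, fun n => (h n).trans (hc n)⟩

/-- **BLMW 2011 §9.1 (p. 20): "We remark that when replacing polynomial upper bounds by
quasipolynomial upper bounds `2^{log^c n}` in the definitions of the above three complexity classes,
then all these classes coincide"** — the `VP_ws` link, `VQP_ws = VQP`: for a p-family over a field,
`n ↦ L_ws(f_n)` is qp-bounded iff `n ↦ L(f_n)` is (`⇒`: `L ≤ L_ws`; `⇐`: through `VQP_e = VQP`,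
the tree's `BCS1997_thm_21_33_holds`, and `L_ws ≤ L_e`). [cite: BurgisserEtAl2011, §9.1 (quasipolynomial bounds: the classes coincide)] -/
theorem isQPBounded_wsComplexity_iff_isQPBounded_complexity {f : ∀ n, MvPolynomial (σ n) k}
    (hf : IsPFamily f) :
    IsQPBounded (fun n => wsComplexity (f n)) ↔ IsQPBounded fun n => complexity (f n) :=
  ⟨fun h => isQPBounded_of_le h fun n => complexity_le_wsComplexity (f n),
    fun h => isQPBounded_of_le ((BCS1997_thm_21_33_holds k σ f hf).2 h) fun n =>
      wsComplexity_le_formulaComplexity (f n)⟩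

/-- The `VP_e` link of the same remark, `VQP_e = VQP_ws`: for a p-family over a field,
`n ↦ E(f_n)` is qp-bounded iff `n ↦ L_ws(f_n)` is. [cite: BurgisserEtAl2011, §9.1 (quasipolynomial bounds: the classes coincide)] -/
theorem isQPBounded_formulaComplexity_iff_isQPBounded_wsComplexity {f : ∀ n, MvPolynomial (σ n) k}
    (hf : IsPFamily f) :
    IsQPBounded (fun n => formulaComplexity (f n)) ↔ IsQPBounded fun n => wsComplexity (f n) := by
  rw [isQPBounded_wsComplexity_iff_isQPBounded_complexity hf]
  exact BCS1997_thm_21_33_holds k σ f hf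

/-- Class form: `f ∈ VQP` iff `f` is a p-family with qp-bounded weakly-skew complexity (the class
"`VQP_ws`" of the remark equals `VQP`; with the tree's `IsVQPeFamily ↔ IsVQPFamily`,
`BCS1997_thm_21_33.isVQPeFamily_iff`, all three coincide). [cite: BurgisserEtAl2011, §9.1 (quasipolynomial bounds: the classes coincide)] -/
theorem isVQPFamily_iff_isQPBounded_wsComplexity (f : ∀ n, MvPolynomial (σ n) k) :
    IsVQPFamily f ↔ IsPFamily f ∧ IsQPBounded fun n => wsComplexity (f n) :=
  ⟨fun h => ⟨h.1, (isQPBounded_wsComplexity_iff_isQPBounded_complexity h.1).2 h.2⟩,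
    fun h => ⟨h.1, (isQPBounded_wsComplexity_iff_isQPBounded_complexity h.1).1 h.2⟩⟩

end QuasiPolynomial

/-! ## "VNP_e = VNP_ws = VNP" -/

namespace ArithExpr

variable {k : Type*} [CommSemiring k] {σ : Type*}

/-- An arithmetic expression (BCS (21.19), the carrier `ArithExpr` of `PermanentCompleteness.lean`)
is a weighted expression with unit weights, of the same size and value. [cite: BurgisserClausenShokrollahi1997, (21.19)] -/
theorem exists_wexpr (φ : ArithExpr k σ) : ∃ e : WExpr k σ, e.eval = φ.eval ∧ e.size = φ.size := by
  induction φ with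
  | var i => exact ⟨.var i, WExpr.eval_var i, rfl⟩
  | const c => exact ⟨.const c, WExpr.eval_const c, rfl⟩
  | add φ₁ φ₂ ih₁ ih₂ =>
    obtain ⟨e₁, he₁, hs₁⟩ := ih₁
    obtain ⟨e₂, he₂, hs₂⟩ := ih₂
    exact ⟨.lin 1 e₁ 1 e₂, by rw [WExpr.eval_lin, he₁, he₂, one_smul, one_smul, eval_add],
      by rw [WExpr.size_lin, hs₁, hs₂, size_add]⟩
  | mul φ₁ φ₂ ih₁ ih₂ =>
    obtain ⟨e₁, he₁, hs₁⟩ := ih₁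
    obtain ⟨e₂, he₂, hs₂⟩ := ih₂
    exact ⟨.mul e₁ e₂, by rw [WExpr.eval_mul, he₁, he₂, eval_mul],
      by rw [WExpr.size_mul, hs₁, hs₂, size_mul]⟩

/-- `E(val φ) ≤ E(φ)` for an arithmetic expression `φ` (the tree's minimal formula size against the
syntactic size of BCS (21.19)). [cite: BurgisserClausenShokrollahi1997, (21.19)] -/
theorem formulaComplexity_eval_le (φ : ArithExpr k σ) : formulaComplexity φ.eval ≤ φ.size := by
  obtain ⟨e, he, hs⟩ := φ.exists_wexpr
  rw [← he, ← hs]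
  exact e.formulaComplexity_eval_le

/-- `L_ws(val φ) ≤ E(φ)`: an arithmetic expression is computed by a weakly-skew circuit of at most
its size (BLMW 2011 §9.1, `L_ws ≤ L_e`). [cite: BurgisserEtAl2011, §9.1 (L_e ≥ L_ws)] -/
theorem wsComplexity_eval_le (φ : ArithExpr k σ) : wsComplexity φ.eval ≤ φ.size :=
  (wsComplexity_le_formulaComplexity _).trans φ.formulaComplexity_eval_le

end ArithExpr

section VNPws

variable {k : Type*} [Field k]

/-- **BLMW 2011 §9.1 (p. 20): "A sequence `(f_n)` belongs to `VNP_?` if there exists a polynomial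
`p` and a sequence `(g_n) ∈ VP_?` such that `f_n(x) = ∑_e g_n(x,e)` … It is a nontrivial fact that
the resulting classes are the same: `VNP_e = VNP_ws = VNP`"** — the `VNP_ws` link, over a field,
for families in the variables `Fin (v n)`: `f ∈ VNP` iff `f` is a p-family and a Boolean sum, over
p-boundedly many Boolean variables, of a family of p-bounded weakly-skew complexity. (⇒) Valiant's
`VNP = VNP_e` in the tree (`BCS1997_thm_21_26_holds`, `VNPeEqVNP.lean`) and `L_ws ≤ L_e`
(`ArithExpr.wsComplexity_eval_le`); (⇐) `VP_ws ⊆ VP` (`IsVPwsFamily.isVPFamily`; the summand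
family has `v n + u n` variables) and the definition of `VNP`. [cite: BurgisserEtAl2011, §9.1 (VNP_e = VNP_ws = VNP)] -/
theorem isVNPFamily_iff_exists_isVPwsFamily_boolSum {v : ℕ → ℕ}
    (f : ∀ n, MvPolynomial (Fin (v n)) k) :
    IsVNPFamily f ↔ IsPFamily f ∧ ∃ (u : ℕ → ℕ) (g : ∀ n, MvPolynomial (Fin (v n) ⊕ Fin (u n)) k),
      IsPBounded u ∧ IsVPwsFamily g ∧ ∀ n, f n = boolSum (g n) := by
  constructor
  · intro hf
    obtain ⟨w, s, hw, hs, φ, hφs, hφ⟩ := BCS1997_thm_21_26_holds k v f hf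
    exact ⟨hf.1, w, fun n => (φ n).eval, hw,
      hs.mono fun n => (φ n).wsComplexity_eval_le.trans (hφs n), hφ⟩
  · rintro ⟨hpf, u, g, hu, hg, hsum⟩
    refine ⟨hpf, u, g, hg.isVPFamily ?_, hsum⟩
    have hv : IsPBounded v := by simpa [Fintype.card_fin] using hpf.1
    simpa [Fintype.card_sum, Fintype.card_fin] using IsPBounded.add_holds hv hu

/-- The `VNP_e` link of the same statement (`VNP_e = VNP`, Valiant 1982 / BCS Thm. (21.26), in
the tree's measure `E = formulaComplexity`): `f ∈ VNP` iff `f` is a p-family and a Boolean sum,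
over p-boundedly many Boolean variables, of a family of p-bounded expression size.
[cite: BurgisserEtAl2011, §9.1 (VNP_e = VNP_ws = VNP)] -/
theorem isVNPFamily_iff_exists_isPBounded_formulaComplexity_boolSum {v : ℕ → ℕ}
    (f : ∀ n, MvPolynomial (Fin (v n)) k) :
    IsVNPFamily f ↔ IsPFamily f ∧ ∃ (u : ℕ → ℕ) (g : ∀ n, MvPolynomial (Fin (v n) ⊕ Fin (u n)) k),
      IsPBounded u ∧ IsPBounded (fun n => formulaComplexity (g n)) ∧ ∀ n, f n = boolSum (g n) := by
  constructor
  · intro hf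
    obtain ⟨w, s, hw, hs, φ, hφs, hφ⟩ := BCS1997_thm_21_26_holds k v f hf
    exact ⟨hf.1, w, fun n => (φ n).eval, hw,
      hs.mono fun n => (φ n).formulaComplexity_eval_le.trans (hφs n), hφ⟩
  · rintro ⟨hpf, u, g, hu, hg, hsum⟩
    exact (isVNPFamily_iff_exists_isVPwsFamily_boolSum f).2
      ⟨hpf, u, g, hu, IsVPwsFamily.of_isPBounded_formulaComplexity hg, hsum⟩

end VNPws

end Literature.Computability.AlgebraicComplexity
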